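import Mathlib
import HarnessLib
import HarnessLib.Audit
import Summits.ResolutionOfSingularities.Statement
import HarnessLib.Audit.Status.Attr

/-!
Route: UniversalCells

# Route UniversalCells — Mnëv universality puts every singularity in one explicit family over F_p;
certify that family's resolution, descend, patch

It suffices to show X = T ∧ D. T (PRIME-FIELD THESIS, target, DERIVED inside the deciding theorem):
every integral separated scheme of
finite type over the PRIME FIELD F_p = ZMod p has a resolution. D (descent): PrimeFieldToPerfect
(F_p ⇒ all perfect fields of
characteristic p; new rung) ∧ DescentPerfectToAll (perfect ⇒ all fields; shared verbatim with routes
Descent / WeightedInvariant /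
UniformComplexity, stmt-0549). The route's content is HOW T is reached — by UNIVERSALITY and a
CERTIFICATE, not by an invariant:
Universality (Mnëv–Lafforgue–Lee–Vakil, matrix form: every point of every integral finite-type
F_p-scheme Y has an open of Y × A^s
around a point over it that is simultaneously an open of a partial matroid stratum of 3 × (3+m)
matrices [I₃ | A] over F_p — finitely
many 3 × 3 minors inverted, finitely many set to zero) → MatroidCellRes (rank 2, the certificate
crux: integral schemes open-immersed in
those strata are locally resolvable; Hu arXiv:2507.21400 Thm 1.3 claims ONE explicit blow-up tower
of the chart p_123 ≠ 0 of Gr(3,n)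
does it for all n at once, and each instance is a finite Jacobian computation over F_p) →
ProductDescent (rank 3: local resolvability
descends from an open of Y × A^s to Y) → LocalToGlobal (rank 4: pointwise-local resolvability of all
integral finite-type F_p-schemes ⇒
resolutions). Cards realised: universal-plucker-tower (spine),
monotone-in-dimension-product-descent-v2 (= ProductDescent).
Lean: `PrimeFieldThesis ∧ PrimeFieldToPerfect ∧ DescentPerfectToAll`

## Assembly
Pure logic (sorry-free in Sketch.lean, theorem closes): fix p prime; DescentPerfectToAll reduces the
summit at p to perfect fields,
PrimeFieldToPerfect to integral schemes over F_p = ZMod p; LocalToGlobal to pointwise-local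
resolvability of an integral Y; at y ∈ Y,
Universality gives (W, j, i, w); MatroidCellRes applied to (W, i) gives an open W' ∋ w with a
resolution; ProductDescent applied to
(W, j, w, W') gives an open U ∋ y of Y with a resolution. Restriction of resolutions to opens
(Literature …Scheme.HasResolution.restrict)
is already proved in tree and is what makes 'stratum resolved ⇒ open-immersed W locally resolved'
immediate for provers of MatroidCellRes.

Rationale: WHY THIS LINE. Operator computational-witness. Mnëv–Sturmfels universality (Mnev1988;
scheme-theoretic: Lafforgue2003 Thm I.14, LeeVakil2012 Thm 1.1
and §2(b)) says the singularities of ALL schemes of finite type over Z — in particular of every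
variety over the prime field F_p — occur,
up to smooth morphisms, on ONE explicit countable family: the matroid strata of 3 × n matrices (thin
Schubert cells of Gr(3,n)), cut out
by 3 × 3 minors with coefficients ±1 and no p-th powers anywhere; Hu2025 (arXiv:2507.21400, Thm
1.1/1.3, unrefereed, Part II pending)
claims one tower of blow-ups of the chart p_123 ≠ 0, each centre the intersection of two smooth
coordinate divisors, whose strict
transforms of all integral Γ-schemes are smooth over F_p and Q, verified by computing Jacobians — no
invariant, no valuation, no
alteration, no induction on dimension, and for every fixed n a finite machine-checkable computation
(CoreyLuber2023: over C the strata
are smooth for n ≤ 11 and first nodal at n = 12, computed in OSCAR). Imported areas: matroid theory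
/ combinatorial algebraic geometry
(Gelfand–MacPherson correspondence, realization spaces), computer-algebra certification. The route
makes the three arrows Hu does not
supply into typed cruxes — product descent (Hu2021 §9 p.64 asserts the slice step without proof;
false as a method in char p),
Zariski-local-to-global (Hu2021 p.65: 'it remains to glue finitely many local resolutions'), and the
climb from F_p to all fields —
and states the engine as an OUTPUT (local resolvability of the universal family) that a compute seat
can attack stratum by stratum.
No open route uses universality, a universal family, or certificates: the six levers on the ledger
are LU + patching (Valuative,
CyclicCovers), alterations (pAlteration), field descent (Descent), prime-MODEL transfer
(UniformComplexity) and weighted invariants.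

RANKED CRUXES. #0 PrimeFieldThesis (target) — for every prime p, every integral separated scheme of
finite type over Spec (ZMod p) has a resolution (proper birational from a regular scheme). Derived
in `closes` from Universality, MatroidCellRes, ProductDescent, LocalToGlobal; implied by the summit
(Sketch.lean primeFieldThesis_of_summit). (why it might fail: It is the summit over the prime field:
the catalogued dimension-≥4 pathologies (kangaroo, Hauser–Perlega, CP Rem 3.2) are hypersurfaces
defined over F_p, so nothing is excluded; refutable only together with the summit.) [Kollar2007,
CossartPiltant2019, Hu2021, Literature.Barriers.ResolutionOfSingularities.DimensionFourFrontier]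
#2 MatroidCellRes (crux) — CERTIFIED RESOLUTION OF THE UNIVERSAL FAMILY (card
universal-plucker-tower K1/K3, stated as the tower's output): for every prime p, m, every finite set
Γ₊ and every set Γ₀ of column triples, every INTEGRAL scheme W admitting an open immersion into the
partial matroid stratum P(p,m,Γ₊,Γ₀) = Spec of (F_p[a_ij : 3×m] / (3×3 minors of [I₃|A] indexed by
Γ₀)) localised at the product of the minors indexed by Γ₊ is locally resolvable: every w ∈ W has an
open neighbourhood with a resolution. Candidate proof: Hu2025 Thm 1.3 (Γ-schemes Z_Γ =
P(p,m,{123},Γ), Z_Γ integral ⇒ the ℓ-transform is smooth over F_p) + restriction to opens (in tree: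
Scheme.HasResolution.restrict). COMPUTE JOB SPEC (first source): kit job over F_2, F_3, F_5 —
enumerate rank-3 matroids on n ≤ 10 elements (and CoreyLuber2023's simple connected 3-lines-property
list for n = 11, 12), build the ideal of nonbasis minors of [I₃|A] saturated by the basis minors,
compute singular loci; for each singular stratum found, produce an explicit resolution certificate
(blow-up charts + Jacobian/Nullstellensatz witnesses) and, on the chart p_123 ≠ 0 of Gr(3,12), run
Hu's ϑ/℘/ℓ-tower on CoreyLuber2023 §4.2's nodal stratum and check regularity of the transform.
[difficulty: open-problem] (why it might fail: By Mnëv universality this IS local resolution of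
everything over F_p, moved to one explicit family; the only uniform candidate is Hu's unrefereed
300-page Jacobian bookkeeping (Thm 1.3 needs Z_Γ integral; an earlier version had a mistake, p.9);
strata smooth over C may be singular over F_p.) [Hu2025, Hu2021, CoreyLuber2023, Lafforgue2003,
LeeVakil2012, Literature.AlgebraicGeometry.Resolution.Scheme.HasResolution.restrict]
#3 ProductDescent (crux) — PRODUCT DESCENT, local form (card
monotone-in-dimension-product-descent-v2 K1): for Y integral separated of finite type over F_p, s ∈
ℕ, W a scheme with an open immersion j into A^s_Y and w ∈ W: if w has an open neighbourhood in W
with a resolution, then the image of w in Y has an open neighbourhood in Y with a resolution.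
[difficulty: L] (why it might fail: Slicing a regular Ũ → W ⊆ Y × A^s at t = a can be singular for
EVERY a in char p (exceptional strata purely inseparable over A^s: blowing up {t = s^p} ⊂ E × A¹
leaves w·y + u^p = 0 on all slices); Hu2021 §9 p.64 asserts the slice is regular without proof; no
Bertini for regularity.) [Hu2021, Liu2002,
Literature.Barriers.ResolutionOfSingularities.InseparableBaseChange, CossartJannsenSaito2020]
#4 LocalToGlobal (crux) — ZARISKI-LOCAL TO GLOBAL over the prime field: if every point of every
integral separated finite-type F_p-scheme has an open neighbourhood with a resolution, then every
integral separated finite-type F_p-scheme has a resolution. (Hu2021 p.65 leaves exactly this: 'it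
remains to glue finitely many local resolutions'.) Strictly weaker than Valuative's PatchingRel:
Zariski-local resolutions give relative local uniformization along every valuation (centre of the
valuation on the local resolution), not conversely. [difficulty: open-problem] (why it might fail:
Existence-only resolutions do not glue: two resolutions of U₁ ∩ U₂ need a common regular dominant,
i.e. resolution again with no dimension drop; Temkin's induction (math/0703678 Prop 2.3.4) needs
SEMI-local resolution along projective fibres; open in dim ≥ 4 even in char 0.) [Hu2021, Temkin2008,
arXiv:math/0703678, CutkoskyMourtada2019, ZariskiSamuel1960,
Literature.Barriers.ResolutionOfSingularities.DimensionFourFrontier]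
#5 PrimeFieldToPerfect (crux) — THE PRIME FIELD SUFFICES FOR PERFECT FIELDS: for a prime p,
resolution of all integral separated finite-type schemes over F_p implies resolution of all reduced
separated finite-type schemes over every PERFECT field k of characteristic p. Two halves: (a) F_p ⇒
finitely generated fields K₀ — spreading out X/K₀ to 𝒳 → S of finite type over F_p, resolving the
total space 𝒳 (an F_p-scheme!) and restricting to the generic fibre (localisation keeps regularity;
EGA IV₃ 8.8.2/8.10.5) — provable; (b) K₀ ⇒ k ⊇ K₀^perf — needs a model over some K₀^(p^-m) whose
resolution is SMOOTH (geometrically regular), i.e. re-resolution after Frobenius twists; plus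
reduced ⇒ integral (in tree: hasResolution_of_forall_closeds) and F_q ⇒ F̄_p (regular ⇒ smooth over
perfect F_q, smooth base change). [difficulty: L] (why it might fail: Half (b): a resolution over
f.g. K₀ base-changes to a regular, not geometrically regular scheme over K₀^perf (quasi-elliptic
fibrations p = 2, 3; cusp y² = x³ + t over F_3(t)); whether finitely many Frobenius twists +
re-resolutions reach smoothness is UniformComplexity's open transfer step.) [EGAIV3, Schroeer2008,
arXiv:math/0608015, Kollar2007, Liu2002,
Literature.Barriers.ResolutionOfSingularities.InseparableBaseChange,
Literature.AlgebraicGeometry.Resolution.hasResolution_of_forall_closeds]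
#6 DescentPerfectToAll (crux) — PerfectToAll (shared verbatim with routes Descent rank 2 /
WeightedInvariant rank 4 / UniformComplexity rank 3, stmt-0549): for a prime p, resolution of all
reduced separated finite-type schemes over all PERFECT fields of char p implies ResolutionInChar p.
[difficulty: open-problem] (why it might fail: Regular ≠ geometrically regular under inseparable
k/K₀ (EGA IV 6.7.4); resolve-a-model-then-base-change needs k/K₀ separable, impossible beyond the
p-rank of k (k = F_p((t))); Temkin2008 Question 3.3.3 open.) [Temkin2008, arXiv:math/0703678,
CossartPiltant2009, Kollar2007, Literature.Barriers.ResolutionOfSingularities.InseparableBaseChange,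
Literature.Barriers.ResolutionOfSingularities.InseparableBaseChangeResolution]
#7 Universality (crux) — MNËV–LAFFORGUE–LEE–VAKIL UNIVERSALITY, matrix form over the prime field
(known theorem, Lean-XL): for Y integral separated of finite type over F_p and y ∈ Y there are m,
Γ₊, Γ₀, s, a scheme W with an open immersion j into A^s_Y and an open immersion i into the partial
matroid stratum P(p,m,Γ₊,Γ₀), W integral, and w ∈ W mapping to y. On paper: LeeVakil2012 Thm 1.1 +
§2(b) (incidence scheme = open of Y × A^s, smooth projection hitting any point), Gelfand–MacPherson
(incidence scheme = free quotient of an open of the matrix stratum by a split torus; Lafforgue2003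
Thm I.11/I.14 = Hu2021 Thms 9.2–9.4), Zariski-local triviality of torsors under split tori (Hilbert
90), integrality of opens of A^N over an integral Y. [difficulty: XL] (why it might fail: True in
print for schemes of finite type over Z (= over F_p here); the matrix transcription (3×3-minor
conditions only, frame normalisation, char-2 configurations of LeeVakil2012 §5, non-closed points
via openness of smooth maps) must be re-verified; Lean-XL: no matroids/Grassmannians in Mathlib.)
[LeeVakil2012, Lafforgue2003, Mnev1988, Hu2021, StacksProject]

TWO-LAYER PLAN. Foreseen glued splits (none filed now): MatroidCellRes ⇐ HuTowerIntegral (Hu2025 Thm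
1.3 verbatim: Z_Γ integral ⇒ ℓ-transform smooth
over F_p) → ReducibleStrata (integral opens of reducible Z_Γ: reduce to an integral Γ'-scheme or
certify directly) → MatroidCellRes, or
by n: DeletionReduction (CoreyLuber2023 Props. 3.x: the deletion map P(n) → P(n−1) is smooth with
connected fibres off the 3-lines
property — provable) → ThreeLinesStrata (the residue) → MatroidCellRes. ProductDescent ⇐
SeparableStrataCriterion (card M2, provable) →
Separabilisation (card K2) → ProductDescent. LocalToGlobal ⇐ IsoOverRegUpgrade →
CommonRegularDominant (two resolutions of one open are
dominated by a third) → LocalToGlobal. PrimeFieldToPerfect ⇐ PrimeToFG (spreading out, provable) →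
FGToPerfect (Frobenius-twist
re-resolution) → PrimeFieldToPerfect.

KILL CRITERIA. Every item is implied by the summit (Universality is a theorem), so a REFUTATION of
MatroidCellRes / ProductDescent / LocalToGlobal /
PrimeFieldToPerfect is a refutation of the summit at that prime: file it as such (problem decided),
do not merely close the route.
The route is closed `superseded`/dormant on USELESSNESS: (i) if the n = 12 certificate (cheapest
falsifier 2) refutes Hu2025 Thm 1.3
and no repaired universal construction is proposed within one tenure cycle — the engine is gone and
MatroidCellRes is just the summit
on a universal family; (ii) if a refuter proves LocalToGlobal ⇔ Valuative.PatchingRel (stmt-0642),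
the local-to-global half merges
into Valuative and the route keeps only the engine; (iii) a misstatement of Universality (matrix
transcription) is repaired by a
restated item, never a closure. PrimeFieldThesis proved elsewhere (any route over F_p) moots ranks
2–4 and leaves the descent rungs.

NOT DECOMPOSED YET. Hu's ϑ/℘/ℓ-tower itself is deliberately NOT itemised (300 pages of notation;
MatroidCellRes is its OUTPUT, so Hu's tower, a repaired
tower, or direct certificates for bounded n all close instances); the torus-descent lemma P1 of the
spine card is not needed
(Universality is stated upstairs on the matrix stratum; the torsor is absorbed Zariski-locally); the
iso-over-Reg upgrade and the
common-dominant lemma inside LocalToGlobal; the two halves of PrimeFieldToPerfect; reduced ⇒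
integral and F_q ⇒ F̄_p bookkeeping
(in tree / folklore). All are layer-2 children once rank 2, 3 or 4 moves (D-0019).

CHEAPEST FALSIFIER. (1) A kit computation, not run this session (planner seat; OSCAR/Singular not on
the hub): matrix matroid strata over F_2, F_3 for
all rank-3 matroids on n ≤ 10 — all regular? first singular (n, M, p)? — calibrates MatroidCellRes
and tests whether characteristic p
drags CoreyLuber2023's first singular stratum below n = 12 (their Thm 1.1 is over C only). (2) The
decisive one for the ENGINE: run
Hu's tower on the chart p_123 ≠ 0 of Gr(3,12) over F_2 and F_3 against CoreyLuber2023 §4.2's nodal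
stratum and check the transform's
Jacobian; a singular transform refutes Hu2025 Thm 1.3 (kill criterion (i)), a regular one is the
first independent evidence. (3) The
lookups I ran: zbMATH has no entry/review of Hu2025 or Hu2021 (2026-08-16); no refutation found; the
ledger negatives index is empty.

NUMBERS. Rank-3 matroid strata: smooth over C for n ≤ 11, nodal examples from n = 12 (CoreyLuber2023
Thms 1.1–1.2); rank 4 smooth for n ≤ 9
(Thm 1.3). Hu's chart p_123 ≠ 0 of Gr(3,n) carries Υ = C(n,3) − 1 − 3(n−3) primary Plücker relations
(n = 12: 192), each
contributing ϑ-, ℘- and ℓ-blow-ups (Hu2025 §1.2–1.5). Dimension ≤ 3 of the summit is known in all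
characteristics
(CossartPiltant2019); the open range starts at 4. Items at open: 8 (1 target, 6 cruxes, 1 assembly =
the type of `closes`).

DEFINITION REQUESTS. None required: the partial matroid stratum is inlined (MvPolynomial (Fin 3 ×
Fin m) (ZMod p), Matrix.fromCols 1 X, 3×3 minors via
Matrix.submatrix/Matrix.det, Ideal.span, Localization.Away, Spec) and local resolvability is inlined
as `∃ U : X.Opens, x ∈ U ∧
HasResolution ↑U`. Optional hygiene later: a Literature definition `MatroidStratum p m Γ₊ Γ₀ :
Scheme` (topic
Literature/AlgebraicGeometry/Grassmannian) to shorten Universality / MatroidCellRes — to be filed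
only if provers ask.

Novelty: Searches (2026-08-16): `lit search --source arxiv "Mnev universality resolution of singularities
Grassmannian"` (0); `--source crossref
"universal characteristic-free resolution of singularity types Grassmannian"` (8, none relevant);
`--source zbmath` ×4 ("Hu Yi
Gamma-schemes singularity types Grassmannian" 0 — no zbMATH entry or review of Hu2025/Hu2021;
"realization spaces matroids rank 3
singular" 2: CoreyLuber2023 arXiv:2307.11915, Kühne–Roulleau arXiv:2312.03470; "desingularization is
not a local problem glue" 0;
"resolution of singularities descends smooth morphism existence positive characteristic" 0);
OpenAlex/S2 HTTP 429, local searchd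
connection reset (recorded in NOTES.md); `lit galaxy search "resolution of singularity types" --star
all` (0) and `"Mnev's universality
theorem" --star all` (3, irrelevant: nonnegative rank, tropical Grassmannian); `lit read`
arXiv:2507.21400 pp.1–10 (Thms 1.1, 1.3,
§1.1–1.6), arXiv:2109.02968 (Thm 1.1, Thms 9.2–9.5, p.64 'system of local parameters', p.65 gluing
remark, Problem 10.1),
arXiv:1202.3934 (Thm 1.1, §2 Strategy (a)–(c)), arXiv:math/0703678 §2.3 (Prop 2.3.4 and its proof),
arXiv:2307.11915 (Thms 1.1–1.3,
Props 3.x); `lean search` (AffineSpace, Matrix.fromCols,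
Scheme.HasResolution.restrict/of_isOpenImmersion — found in tree);
`ledger negatives` (0 refuted); `ledger idea list` (184 cards: universal-plucker-tower
new-combination KEEP ×5 unrouted,
monotone-in-dimension-product-descent-v2 unrouted; grep of the six Theses files fo  [refs: 2307.11915, 2312.03470, 2507.21400, 2109.02968, 1202.3934, math/0703678, Hu2025, Hu2021, CoreyLuber2023, LeeVakil2012, Lafforgue2003]

Barriers (technique_class: universality-reduction, universal-tower, descent): - technique_class: universality-reduction, universal-tower, descent
- Literature.Barriers.ResolutionOfSingularities.Hauser2003_kangarooShadeIncrease: evaded by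
construction — no invariant, residual order or maximal contact is ever consulted; Hu's centres are
codimension-2 intersections of coordinate divisors of the ambient universal space blown up in a
fixed order, individual strata may worsen mid-tower; the barrier can only re-enter as 'the Jacobian
computation is wrong at a wild stratum', which the n = 12, p = 2, 3 certificate tests.
- Literature.Barriers.ResolutionOfSingularities.hauserPerlega_mohProofBoundFails: same evasion (no
point-blow-up strategy, no residual order); not engaged by any crux.
- Literature.Barriers.ResolutionOfSingularities.Narasimhan1983_noSmoothHypersurfaceThroughTopLocus:
evaded — no hypersurface of maximal contact; the equations of the family have no p-th powers at all
(minors with ±1 coefficients), which is Hu's stated reason for the detour (Hu2025 §1.1.1).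
- Literature.Barriers.ResolutionOfSingularities.DimensionFourFrontier: the engine ignores dimension
(all strata of all dimensions at once, no LU, no induction); the frontier's moral returns in
LocalToGlobal (gluing local resolutions is open in dim ≥ 4 even in char 0) — conceded; the bet is
that Zariski-local gluing of honest resolutions is easier than valuation patching (it is implied by
PatchingRel, not conversely).
- Literature.Barriers.ResolutionOfSingularities.InseparableBaseChange: it does

History (route lifecycle, newest last):
- 2026-08-26T06:32:34Z · DORMANT — reconciler: no traction for 8.4 d (last activity item-evidence-added at 2026-08-17T20:51:40Z); parked, not closed — `ledger route dormant route-ResolutionOfSing (operator:999:279971)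
- 2026-08-26T16:26:39Z · REACTIVATED — dormant cleared (operator:999:1144444)

sub-problem: ResolutionOfSingularities · status: open · opened planner-plan-novel-ResolutionOfSingularities-Re-dc19aa3a-d-g2-0 2026-08-16T14:52:04Z · rev 2 · ledger route-ResolutionOfSingularities-UniversalCells
GENERATED by the gate from the ledger (D-0016/17). Provers cite these decls: `theorem foo : Summit.ResolutionOfSingularities.ResolutionOfSingularities.Theses.UniversalCells.<Decl> := …` in Summits/ResolutionOfSingularities/ResolutionOfSingularities/Theorems/<Name>.lean.
-/

namespace Summit.ResolutionOfSingularities.ResolutionOfSingularities.Theses.UniversalCells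

open scoped BigOperators Topology Manifold Classical MeasureTheory ProbabilityTheory Matrix InnerProductSpace ComplexConjugate ContinuousMap
open Filter Set Function TopologicalSpace MeasureTheory

attribute [summit_statement] _root_.ResolutionOfSingularities

/-- item stmt-ResolutionOfSingularities-15229 · target · rank 0 · open · by planner
why it might fail: It is the summit over the prime field: the catalogued dimension-≥4 pathologies (kangaroo, Hauser–Perlega, CP Rem 3.2) are hypersurfaces defined over F_p, so nothing is excluded; refutable only together with the summit.
sources: Kollar2007, CossartPiltant2019, Hu2021, Literature.Barriers.ResolutionOfSingularities.DimensionFourFrontier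
[target] for every prime p, every integral separated scheme of finite type over Spec (ZMod p) has a
resolution (proper birational from a regular scheme). Derived in `closes` from Universality,
MatroidCellRes, ProductDescent, LocalToGlobal; implied by the summit (Sketch.lean
primeFieldThesis_of_summit). -/
@[route_item "route-ResolutionOfSingularities-UniversalCells", crux]
def PrimeFieldThesis : Prop :=
  ∀ p : ℕ, p.Prime → ∀ (X : AlgebraicGeometry.Scheme.{0}) (f : X ⟶ AlgebraicGeometry.Spec (.of (ZMod p))), AlgebraicGeometry.IsSeparated f → AlgebraicGeometry.LocallyOfFiniteType f → AlgebraicGeometry.QuasiCompact f → AlgebraicGeometry.IsIntegral X → Literature.AlgebraicGeometry.Resolution.Scheme.HasResolution X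

/-- item stmt-ResolutionOfSingularities-15230 · crux · rank 2 · open · by planner
why it might fail: By Mnëv universality this IS local resolution of everything over F_p, moved to one explicit family; the only uniform candidate is Hu's unrefereed 300-page Jacobian bookkeeping (Thm 1.3 needs Z_Γ integral; an earlier version had a mistake, p.9); strata smooth over C may be singular over F_p.
sources: Hu2025, Hu2021, CoreyLuber2023, Lafforgue2003, LeeVakil2012, Literature.AlgebraicGeometry.Resolution.Scheme.HasResolution.restrict
[crux] CERTIFIED RESOLUTION OF THE UNIVERSAL FAMILY (card universal-plucker-tower K1/K3, stated as
the tower's output): for every prime p, m, every finite set Γ₊ and every set Γ₀ of column triples,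
every INTEGRAL scheme W admitting an open immersion into the partial matroid stratum P(p,m,Γ₊,Γ₀) =
Spec of (F_p[a_ij : 3×m] / (3×3 minors of [I₃|A] indexed by Γ₀)) localised at the product of the
minors indexed by Γ₊ is locally resolvable: every w ∈ W has an open neighbourhood with a resolution.
Candidate proof: Hu2025 Thm 1.3 (Γ-schemes Z_Γ = P(p,m,{123},Γ), Z_Γ integral ⇒ the ℓ-transform is
smooth over F_p) + restriction to opens (in tree: Scheme.HasResolution.restrict). COMPUTE JOB SPEC
(first source): kit job over F_2, F_3, F_5 — enumerate rank-3 matroids on n ≤ 10 elements (and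
CoreyLuber2023's simple connected 3-lines-property list for n = 11, 12), build the ideal of nonbasis
minors of [I₃|A] saturated by the basis minors, compute singular loci; for each singular stratum
found, produce an explicit resolution certificate (blow-up charts + Jacobian/Nullstellensatz
witnesses) and, on the chart p_123 ≠ 0 of Gr(3,12), run Hu's ϑ/℘/ℓ-tower on CoreyLuber2023 §4.2's
nodal stratum and chec -/
@[route_item "route-ResolutionOfSingularities-UniversalCells", crux]
def MatroidCellRes : Prop :=
  ∀ p : ℕ, p.Prime → ∀ (m : ℕ) (Γp : Finset (Fin 3 → Fin 3 ⊕ Fin m)) (Γ0 : Set (Fin 3 → Fin 3 ⊕ Fin m)), let M : Matrix (Fin 3) (Fin 3 ⊕ Fin m) (MvPolynomial (Fin 3 × Fin m) (ZMod p)) := Matrix.fromCols 1 (Matrix.of fun i j => MvPolynomial.X (i, j)); let I : Ideal (MvPolynomial (Fin 3 × Fin m) (ZMod p)) := Ideal.span ((fun u : Fin 3 → Fin 3 ⊕ Fin m => (M.submatrix id u).det) '' Γ0); ∀ (W : AlgebraicGeometry.Scheme.{0}) (i : W ⟶ AlgebraicGeometry.Spec (.of (Localization.Away (Ideal.Quotient.mk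 I (∏ u ∈ Γp, (M.submatrix id u).det))))), AlgebraicGeometry.IsOpenImmersion i → AlgebraicGeometry.IsIntegral W → ∀ w : W, ∃ W' : W.Opens, w ∈ W' ∧ Literature.AlgebraicGeometry.Resolution.Scheme.HasResolution (W' : AlgebraicGeometry.Scheme.{0})

/-- item stmt-ResolutionOfSingularities-15231 · crux · rank 3 · open · by planner
why it might fail: Slicing a regular Ũ → W ⊆ Y × A^s at t = a can be singular for EVERY a in char p (exceptional strata purely inseparable over A^s: blowing up {t = s^p} ⊂ E × A¹ leaves w·y + u^p = 0 on all slices); Hu2021 §9 p.64 asserts the slice is regular without proof; no Bertini for regularity.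
sources: Hu2021, Liu2002, Literature.Barriers.ResolutionOfSingularities.InseparableBaseChange, CossartJannsenSaito2020
[crux] PRODUCT DESCENT, local form (card monotone-in-dimension-product-descent-v2 K1): for Y
integral separated of finite type over F_p, s ∈ ℕ, W a scheme with an open immersion j into A^s_Y
and w ∈ W: if w has an open neighbourhood in W with a resolution, then the image of w in Y has an
open neighbourhood in Y with a resolution. [difficulty: L] -/
@[route_item "route-ResolutionOfSingularities-UniversalCells", crux]
def ProductDescent : Prop :=
  ∀ p : ℕ, p.Prime → ∀ (Y : AlgebraicGeometry.Scheme.{0}) (f : Y ⟶ AlgebraicGeometry.Spec (.of (ZMod p))), AlgebraicGeometry.IsSeparated f → AlgebraicGeometry.LocallyOfFiniteType f → AlgebraicGeometry.QuasiCompact f → AlgebraicGeometry.IsIntegral Y → ∀ (s : ℕ) (W : AlgebraicGeometry.Scheme.{0}) (j : W ⟶ AlgebraicGeometry.AffineSpace (Fin s) Y), AlgebraicGeometry.IsOpenImmersion j → ∀ w : W, (∃ W' : W.Opens, w ∈ W' ∧ Literature.AlgebraicGeometry.Resolution.Scheme.HasResolution (W' : AlgebraicGeometry.Scheme.{0}))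 → ∃ U : Y.Opens, (CategoryTheory.over (AlgebraicGeometry.AffineSpace (Fin s) Y) Y).base (j.base w) ∈ U ∧ Literature.AlgebraicGeometry.Resolution.Scheme.HasResolution (U : AlgebraicGeometry.Scheme.{0})

/-- item stmt-ResolutionOfSingularities-15232 · crux · rank 4 · open · by planner
why it might fail: Existence-only resolutions do not glue: two resolutions of U₁ ∩ U₂ need a common regular dominant, i.e. resolution again with no dimension drop; Temkin's induction (math/0703678 Prop 2.3.4) needs SEMI-local resolution along projective fibres; open in dim ≥ 4 even in char 0.
sources: Hu2021, Temkin2008, arXiv:math/0703678, CutkoskyMourtada2019, ZariskiSamuel1960, Literature.Barriers.ResolutionOfSingularities.DimensionFourFrontier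
[crux] ZARISKI-LOCAL TO GLOBAL over the prime field: if every point of every integral separated
finite-type F_p-scheme has an open neighbourhood with a resolution, then every integral separated
finite-type F_p-scheme has a resolution. (Hu2021 p.65 leaves exactly this: 'it remains to glue
finitely many local resolutions'.) Strictly weaker than Valuative's PatchingRel: Zariski-local
resolutions give relative local uniformization along every valuation (centre of the valuation on the
local resolution), not conversely. [difficulty: open-problem] -/
@[route_item "route-ResolutionOfSingularities-UniversalCells", crux]
def LocalToGlobal : Prop :=
  ∀ p : ℕ, p.Prime → (∀ (X : AlgebraicGeometry.Scheme.{0}) (f : X ⟶ AlgebraicGeometry.Spec (.of (ZMod p))), AlgebraicGeometry.IsSeparated f → AlgebraicGeometry.LocallyOfFiniteType f → AlgebraicGeometry.QuasiCompact f → AlgebraicGeometry.IsIntegral X → ∀ x : X, ∃ U : X.Opens, x ∈ U ∧ Literature.AlgebraicGeometry.Resolution.Scheme.HasResolution (U : AlgebraicGeometry.Scheme.{0})) → ∀ (X : AlgebraicGeometry.Scheme.{0}) (f : X ⟶ AlgebraicGeometry.Spec (.of (ZMod p))), AlgebraicGeometry.IsSeparated f → AlgebraicGeometry.LocallyOfFiniteType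 f → AlgebraicGeometry.QuasiCompact f → AlgebraicGeometry.IsIntegral X → Literature.AlgebraicGeometry.Resolution.Scheme.HasResolution X

/-- item stmt-ResolutionOfSingularities-15233 · crux · rank 5 · open · by planner
why it might fail: Half (b): a resolution over f.g. K₀ base-changes to a regular, not geometrically regular scheme over K₀^perf (quasi-elliptic fibrations p = 2, 3; cusp y² = x³ + t over F_3(t)); whether finitely many Frobenius twists + re-resolutions reach smoothness is UniformComplexity's open transfer step.
sources: EGAIV3, Schroeer2008, arXiv:math/0608015, Kollar2007, Liu2002, Literature.Barriers.ResolutionOfSingularities.InseparableBaseChange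
[crux] THE PRIME FIELD SUFFICES FOR PERFECT FIELDS: for a prime p, resolution of all integral
separated finite-type schemes over F_p implies resolution of all reduced separated finite-type
schemes over every PERFECT field k of characteristic p. Two halves: (a) F_p ⇒ finitely generated
fields K₀ — spreading out X/K₀ to 𝒳 → S of finite type over F_p, resolving the total space 𝒳 (an
F_p-scheme!) and restricting to the generic fibre (localisation keeps regularity; EGA IV₃
8.8.2/8.10.5) — provable; (b) K₀ ⇒ k ⊇ K₀^perf — needs a model over some K₀^(p^-m) whose resolution
is SMOOTH (geometrically regular), i.e. re-resolution after Frobenius twists; plus reduced ⇒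
integral (in tree: hasResolution_of_forall_closeds) and F_q ⇒ F̄_p (regular ⇒ smooth over perfect
F_q, smooth base change). [difficulty: L] -/
@[route_item "route-ResolutionOfSingularities-UniversalCells", crux]
def PrimeFieldToPerfect : Prop :=
  ∀ p : ℕ, p.Prime → (∀ (X : AlgebraicGeometry.Scheme.{0}) (f : X ⟶ AlgebraicGeometry.Spec (.of (ZMod p))), AlgebraicGeometry.IsSeparated f → AlgebraicGeometry.LocallyOfFiniteType f → AlgebraicGeometry.QuasiCompact f → AlgebraicGeometry.IsIntegral X → Literature.AlgebraicGeometry.Resolution.Scheme.HasResolution X) → ∀ (k : Type) [Field k] [CharP k p] [PerfectField k] (X : AlgebraicGeometry.Scheme.{0}) (f : X ⟶ AlgebraicGeometry.Spec (.of k)), AlgebraicGeometry.IsSeparated f → AlgebraicGeometry.LocallyOfFiniteType f → AlgebraicGeometry.QuasiCompact f → AlgebraicGeometry.IsReduced X → Literature.AlgebraicGeometry.Resolution.Scheme.HasResolution X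

/-- item stmt-ResolutionOfSingularities-0549 · crux · rank 6 · open · by planner
why it might fail: Regular ≠ geometrically regular under inseparable k/K₀ (EGA IV 6.7.4); resolve-a-model-then-base-change needs k/K₀ separable, impossible beyond the p-rank of k (k = F_p((t))); Temkin2008 Question 3.3.3 open.
sources: Temkin2008, arXiv:math/0703678, CossartPiltant2009, Kollar2007, Literature.Barriers.ResolutionOfSingularities.InseparableBaseChange, Literature.Barriers.ResolutionOfSingularities.InseparableBaseChangeResolution
PerfectToAll: for a prime p, resolution of all reduced separated finite-type schemes over all
PERFECT fields of char p implies ResolutionInChar p (all fields of char p). Expected inputs: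
Neron-Popescu (Stacks 07GC), spreading out, openness of regular locus on excellent schemes;
regularity is not stable under inseparable ground field extension, which is the difficulty. -/
@[route_item "route-ResolutionOfSingularities-UniversalCells", crux]
def DescentPerfectToAll : Prop :=
  ∀ p : ℕ, p.Prime → (∀ (k : Type) [Field k] [CharP k p] [PerfectField k] (X : AlgebraicGeometry.Scheme.{0}) (f : X ⟶ AlgebraicGeometry.Spec (.of k)), AlgebraicGeometry.IsSeparated f → AlgebraicGeometry.LocallyOfFiniteType f → AlgebraicGeometry.QuasiCompact f → AlgebraicGeometry.IsReduced X → Literature.AlgebraicGeometry.Resolution.Scheme.HasResolution X) → Literature.AlgebraicGeometry.Resolution.ResolutionInChar.{0} p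

/-- item stmt-ResolutionOfSingularities-15234 · crux · rank 7 · closed · proved by Summit.ResolutionOfSingularities.ResolutionOfSingularities.Theorems.UniversalCells.Universality_proof @ a6b0a8d15420 (prover) · by planner
why it might fail: True in print for schemes of finite type over Z (= over F_p here); the matrix transcription (3×3-minor conditions only, frame normalisation, char-2 configurations of LeeVakil2012 §5, non-closed points via openness of smooth maps) must be re-verified; Lean-XL: no matroids/Grassmannians in Mathlib.
sources: LeeVakil2012, Lafforgue2003, Mnev1988, Hu2021, StacksProject
[crux] MNËV–LAFFORGUE–LEE–VAKIL UNIVERSALITY, matrix form over the prime field (known theorem,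
Lean-XL): for Y integral separated of finite type over F_p and y ∈ Y there are m, Γ₊, Γ₀, s, a
scheme W with an open immersion j into A^s_Y and an open immersion i into the partial matroid
stratum P(p,m,Γ₊,Γ₀), W integral, and w ∈ W mapping to y. On paper: LeeVakil2012 Thm 1.1 + §2(b)
(incidence scheme = open of Y × A^s, smooth projection hitting any point), Gelfand–MacPherson
(incidence scheme = free quotient of an open of the matrix stratum by a split torus; Lafforgue2003
Thm I.11/I.14 = Hu2021 Thms 9.2–9.4), Zariski-local triviality of torsors under split tori (Hilbert
90), integrality of opens of A^N over an integral Y. [difficulty: XL] -/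
@[route_item "route-ResolutionOfSingularities-UniversalCells", crux]
def Universality : Prop :=
  ∀ p : ℕ, p.Prime → ∀ (Y : AlgebraicGeometry.Scheme.{0}) (f : Y ⟶ AlgebraicGeometry.Spec (.of (ZMod p))), AlgebraicGeometry.IsSeparated f → AlgebraicGeometry.LocallyOfFiniteType f → AlgebraicGeometry.QuasiCompact f → AlgebraicGeometry.IsIntegral Y → ∀ y : Y, ∃ (m : ℕ) (Γp : Finset (Fin 3 → Fin 3 ⊕ Fin m)) (Γ0 : Set (Fin 3 → Fin 3 ⊕ Fin m)) (s : ℕ) (W : AlgebraicGeometry.Scheme.{0}) (j : W ⟶ AlgebraicGeometry.AffineSpace (Fin s) Y) (w : W), let M : Matrix (Fin 3) (Fin 3 ⊕ Fin m) (MvPolynomial (Fin 3 × Fin m) (ZMod p)) := Matrix.fromCols 1 (Matrix.of fun i j => MvPolynomial.X (i, j)); let I : Ideal (MvPolynomial (Fin 3 × Fin m) (ZMod p)) := Ideal.span ((fun u : Fin 3 → Fin 3 ⊕ Fin m => (M.submatrix id u).det) '' Γ0); ∃ i : W ⟶ AlgebraicGeometry.Spec (.of (Localization.Away (Ideal.Quotient.mk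 I (∏ u ∈ Γp, (M.submatrix id u).det)))), AlgebraicGeometry.IsOpenImmersion j ∧ AlgebraicGeometry.IsOpenImmersion i ∧ AlgebraicGeometry.IsIntegral W ∧ (CategoryTheory.over (AlgebraicGeometry.AffineSpace (Fin s) Y) Y).base (j.base w) = y

-- `Universality` holds: proved by `Summit.ResolutionOfSingularities.ResolutionOfSingularities.Theorems.UniversalCells.Universality_proof` @ a6b0a8d15420 (its module imports this route file, so no `_holds` link can be stated here).

/-- item stmt-ResolutionOfSingularities-15235 · assembly · rank 1 · closed · proved by Summit.ResolutionOfSingularities.ResolutionOfSingularities.Theorems.UniversalCells.assembly_proof @ 5c628d285a1d (prover) · by planner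
sources: Hu2025, LeeVakil2012, Temkin2008
[assembly] Universality → MatroidCellRes → ProductDescent → LocalToGlobal → PrimeFieldToPerfect →
DescentPerfectToAll → the summit statement (the type of `closes`; closable at once by `theorem
assembly_proof : Assembly := closes`). -/
@[route_item "route-ResolutionOfSingularities-UniversalCells"]
def Assembly : Prop :=
  Universality → MatroidCellRes → ProductDescent → LocalToGlobal → PrimeFieldToPerfect → DescentPerfectToAll → _root_.ResolutionOfSingularities

-- `Assembly` holds: proved by `Summit.ResolutionOfSingularities.ResolutionOfSingularities.Theorems.UniversalCells.assembly_proof` @ 5c628d285a1d (its module imports this route file, so no `_holds` link can be stated here).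

/-! D-0027 §2.1 — DECIDING THEOREM (planner-authored via `route open/edit --closes-file`; by planner-plan-novel-ResolutionOfSingularities-Re-dc19aa3a-d-g 2026-08-16T14:52:04Z):
its hypotheses are this route's items and its conclusion the sub-problem Statement (glue_lint), and it elaborates with this file. -/

/-- DECIDING THEOREM of route UniversalCells (D-0027 §2.1), pure logic over the route's six cruxes.
First the route's TARGET `PrimeFieldThesis` (resolution of integral separated finite-type schemes
over the prime field `𝔽_p = ZMod p`) is DERIVED: `LocalToGlobal` reduces it to pointwise-local
resolvability of every such `Y`; at `y ∈ Y`, `Universality` (Mnëv–Lafforgue–Lee–Vakil, matrix form)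
gives an integral scheme `W`, an open immersion `j : W ⟶ 𝔸ˢ_Y`, an open immersion `i` of `W` into a
partial matroid stratum of `3 × (3+m)` matrices over `𝔽_p`, and `w ∈ W` over `y`; `MatroidCellRes`
(the certificate crux) gives an open `W' ∋ w` of `W` with a resolution; `ProductDescent` carries it
down to an open `U ∋ y` of `Y`. Then, prime by prime, `PrimeFieldToPerfect` lifts the target to all
perfect fields and `DescentPerfectToAll` (shared stmt-0549) to `ResolutionInChar p`, i.e. the
Statement. Chain: Universality ⇒ MatroidCellRes ⇒ ProductDescent ⇒ LocalToGlobal ⇒ PrimeFieldThesis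
⇒ (PrimeFieldToPerfect) ⇒ perfect fields ⇒ (DescentPerfectToAll) ⇒ Statement. -/
@[closes "route-ResolutionOfSingularities-UniversalCells"] theorem closes (hU : Universality) (hC : MatroidCellRes) (hD : ProductDescent) (hL : LocalToGlobal)
    (hP : PrimeFieldToPerfect) (hA : DescentPerfectToAll) : _root_.ResolutionOfSingularities := by
  -- the target, derived (not assumed)
  have hT : PrimeFieldThesis := by
    intro p hp X f hs hl hq hint
    refine hL p hp ?_ X f hs hl hq hint
    intro Y g hs' hl' hq' hint' y
    obtain ⟨m, Γp, Γ0, s, W, j, w, i, hj, hi, hW, hy⟩ := hU p hp Y g hs' hl' hq' hint' y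
    obtain ⟨W', hw', hres⟩ := hC p hp m Γp Γ0 W i hi hW w
    obtain ⟨U, hU', hresU⟩ := hD p hp Y g hs' hl' hq' hint' s W j hj w ⟨W', hw', hres⟩
    exact ⟨U, hy ▸ hU', hresU⟩
  -- descent: prime field ⇒ perfect fields ⇒ all fields of characteristic p
  exact fun p hp => hA p hp (hP p hp (hT p hp))

end Summit.ResolutionOfSingularities.ResolutionOfSingularities.Theses.UniversalCells
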